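import Summits.HodgeConjecture.HodgeConjecture.Theorems.Ring2HypothesesProductSlices
import Summits.HodgeConjecture.HodgeConjecture.Theorems.Ring2HypothesesMultiWeilVsPullbacksNamed
import Summits.HodgeConjecture.HodgeConjecture.Theorems.Ring2HypothesesMultiWeilCensus
import Summits.HodgeConjecture.HodgeConjecture.Theorems.Ring2ClassTargetsSevenfoldSeeds
import Literature.AlgebraicGeometry.HodgeTheory.WeilClassesRationalPlane
import HarnessLib

/-!
# Part XXI — (G) against the FULL pull-back shape (P⁺) `IsFullWeilPullbackGenerated` (research route conditional on HC_CM; not a corollary; Q11.4-sentence-2 already refuted in dim ≥ 3)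

Typer 2 (hypotheses layer), cell `pub-hodge-ring2`, answering the LEAD's gen-9 part-3 ask. Typer 1's
`Ring2ClassTargetsSevenfoldSeeds` (p195321) types the member shape (P⁺) = `IsFullWeilPullbackGenerated A`:
codimension `2` generated by `D²` and André's pull-backs `codimTwoWeilPullbacks A`, codimension `3` by `D³`, `B²·B¹`
AND the Weil-SIXFOLD pull-backs `codimThreeWeilSixfoldPullbacks A`, and proves (P) ⟹ (P⁺). The LEAD asked whether
"(G) ⟹ (P⁺) on sixfolds" needs anything beyond "each Weil plane is spanned by its rational `(3,3)` classes". It does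
not, and that spanning is a TREE THEOREM (van Geemen 4.9, `weilClassesOf_eq_span_isRationalClass`: the Weil plane
`W_K ⊗ ℂ` is the complex span of its rational classes), already used by part XVII §1
(`Ring2HypothesesMultiWeilCensus`: `allWeilClasses_two_le_span_codimTwoWeilPullbacks`,
`allWeilClasses_three_le_span_weilPullbacks`) for the census clauses. Consequences typed here, all UNCONDITIONAL
implications between typed predicates (no member is asserted to have any shape):

* §1 Both seed sets contain the member's OWN rational Weil classes (`B = A`, `g = 𝟙`); part XVII's spanning rows
  re-pointed to typer 1's NAMED seed set `codimThreeWeilSixfoldPullbacks` (definitionally X1's fourth summand).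
* §2 **(G) ⟹ (P⁺) in EVERY dimension** (`isFullWeilPullbackGenerated_of_isDivisorMultiWeilGenerated`); with
  typer 1's (P) ⟹ (P⁺) and part XIX-B's `B = D` ⟹ (P): **(P⁺) is implied by each of the three member shapes
  `B = D`, (G), (P)** — it is an upper bound of the member-shape family. Sharper OFF dimension `6`: **(G) ⟹ (P)**
  (`isWeilPullbackGenerated_of_isDivisorMultiWeilGenerated_of_dim_ne_six`; this covers odd dimension, row `7` and the
  Weil FOURFOLDS, and fails exactly in dimension `6` by part XIX's O1). On a (G)-sixfold with one rational `(3,3)`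
  class outside `D³ ⊗ ℂ`: (P⁺) holds and (P) fails (member form; members in print: the Weil-type sixfolds).
* §3 (P⁺) DESCENDS along a section of a projection (the Weil-sixfold seeds are stable under `i^*` exactly as André's:
  `i^* g^* = (i ≫ g)^*`), hence from `T × Y` to both factors; and the classes reading rule r5 found MISSING from (P)
  on `T × Y₆` — the pull-backs `pr₂^* w` of the sixfold factor's Weil classes — are (P⁺)-seeds BY NAME, so for a
  (G)-sixfold `Y` every class `pr₂^* c`, `c` a rational `(3,3)` class of `Y`, is (P⁺)-generated on `T × Y`
  (`map_snd_mem_divisorClassesSpan_sup_span_seeds_of_isDivisorMultiWeilGenerated`). Whether `T × Y₆` itself has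
  (P⁺) is a statement about the MIXED Künneth components and stays a member hypothesis (atlas numbers, rule r4).
* §4 (P⁺) ⇏ (G): one rational `(2,2)` class outside `D² ⊗ ℂ` in dimension `≠ 4` kills (G) whatever else holds
  (members: the K3 partners and their products up the tower, cell computation K3-WP).
* §5 Rows `6, 7` and the census clauses off a class `𝒞` from "every 6- and 7-fold outside `𝒞` has ONE OF the four
  shapes" — typer 1's per-member theorem after §2 (prices: floor fact, `CodimTwoWeilClassesCMFieldOff 𝒞`,
  `WeilSixfoldsOff 𝒞`; `HC_CM` enters only if one takes `𝒞 = CM`, as an INSTANCE of HC on `𝒞`, typer 1 §K4).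

HONEST STATUS. `HC_CM` (`Theses.RankFourFaces.CMAbelianHodge`, stmt-HodgeConjecture-3052) does not occur. (G), (P),
(P⁺), `B = D` are HYPOTHESES on members (census statements, cell inference or computation), never asserted; which of
the 44 atlas rows of dimensions `6, 7` has which shape is recorded in the cell map (RING2-MAP §hypotheses gen 11–12),
not here. After this file: 39 of those rows carry (P⁺) by a KERNEL implication from their recorded shape (25 with
`B = D`, 9 with (G), 5 with (P): the three K3-partner sixfolds and, by the atlas seats' certified product-span
computation, `E³ × Y₃` and `E⁴ × Y₃`); the five `B ≠ D` sevenfold rows with a Weil-type sixfold inside carry (P⁺)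
as a member hypothesis read from certified numbers, with the kernel supplying only seed membership (§3), descent, and
the failure of (P) as a schema (part XX). Every shape attribution to a row is a cell record (census, inference or
computation), not a theorem of this file. Nothing here decides HC of any cell; no definition, no `sorry`, no named
fact introduced.

References: [cite: vanGeemen1994HodgeAV, 4.9–4.11, Lemma 5.2, Thm. 6.12] [cite: MoonenZarhin1999LowDim, Thm. 0.2
(e),(f), (2.7)–(2.8) and §5] [cite: Deligne1982HodgeCycles, §4 (4.3)–Prop. 4.4] [cite: Andre1992HodgeCM, Théorème]
[cite: HatcherAT2002, §3.2 Prop. 3.10] [cite: Fulton1998, §10.1] [cite: Weil1977HodgeRing]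
-/

set_option linter.dupNamespace false

open CategoryTheory MonoidalCategory
open Literature.AlgebraicGeometry Literature.AlgebraicGeometry.Motives
open Literature.AlgebraicGeometry.HodgeTheory
open Literature.AlgebraicTopology.SingularHomology
open Literature.Barriers.HodgeConjecture (divisorClassesSpan)
open Summit.HodgeConjecture.HodgeConjecture.Theses
open Summit.HodgeConjecture.HodgeConjecture.Ring2.ClassTargets

namespace Summit.HodgeConjecture.HodgeConjecture.Ring2.Hypotheses

variable {A A' : AbelianVariety ℂ}

/-! ## §1 The seed sets contain the member's own Weil classes -/

/-- A rational class of the Weil plane of a Weil structure of type `(2, d)` on `A` is one of André's codimension-2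
pull-backs to `A` (`B = A`, `g = 𝟙`). [cite: vanGeemen1994HodgeAV, 4.9–4.10] [cite: Andre1992HodgeCM, Théorème] -/
theorem mem_codimTwoWeilPullbacks_self {φ : A ⟶ A} {d : ℕ} (hW : IsWeilType A φ 2 d)
    {c : complexBetti A.X (2 * 2)} (hc : IsRationalClass c) (hcW : c ∈ weilClassesOf A φ 2 d) :
    c ∈ codimTwoWeilPullbacks A :=
  Or.inl ⟨A, 𝟙 A.X, d, φ, c, hW.dim_eq, hW.d_pos, hW.sq_eq, hc, hW.isOfHodgeType_of_mem_weilClassesOf hcW, hcW,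
    by rw [complexBetti.map_id]; rfl⟩

/-- A rational class of the Weil plane of a Weil structure of type `(3, d)` on `A` is a Weil-SIXFOLD pull-back to
`A` (`B = A`, `g = 𝟙`). [cite: vanGeemen1994HodgeAV, 4.9–4.10] [cite: MoonenZarhin1999LowDim, §5] -/
theorem mem_codimThreeWeilSixfoldPullbacks_self {φ : A ⟶ A} {d : ℕ} (hW : IsWeilType A φ 3 d)
    {c : complexBetti A.X (2 * 3)} (hc : IsRationalClass c) (hcW : c ∈ weilClassesOf A φ 3 d) :
    c ∈ codimThreeWeilSixfoldPullbacks A :=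
  ⟨A, 𝟙 A.X, d, φ, c, by rw [hW.dim_eq], hW.d_pos, hW.sq_eq, hc,
    by rw [hW.dim_eq]; exact hW.isOfHodgeType_of_mem_weilClassesOf hcW, hcW, by rw [complexBetti.map_id]; rfl⟩

/-- **The Weil plane of a type-`(3, d)` structure lies in the span of the Weil-sixfold pull-backs** — part XVII's
`weilClassesOf_three_le_span_weilPullbacks` against typer 1's NAMED seed set (definitional unfolding; the plane is
the complex span of its rational classes, van Geemen 4.9). [cite: vanGeemen1994HodgeAV, 4.9]
[cite: Deligne1982HodgeCycles, §4 (4.3)–(4.4)] -/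
theorem weilClassesOf_le_span_codimThreeWeilSixfoldPullbacks {φ : A ⟶ A} {d : ℕ} (hW : IsWeilType A φ 3 d) :
    weilClassesOf A φ 3 d ≤ Submodule.span ℂ (codimThreeWeilSixfoldPullbacks A) :=
  weilClassesOf_three_le_span_weilPullbacks hW

/-- `Σ_k W_k ⊗ ℂ` in degree `6` (all Weil structures of type `(3, ·)`) lies in the span of the NAMED Weil-sixfold
pull-backs (part XVII's `allWeilClasses_three_le_span_weilPullbacks`, re-pointed); the degree-`4` companion is part
XVII's `allWeilClasses_two_le_span_codimTwoWeilPullbacks` verbatim. [cite: vanGeemen1994HodgeAV, 4.9 and 4.13]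
[cite: MoonenZarhin1999LowDim, §5] -/
theorem allWeilClasses_three_le_span_codimThreeWeilSixfoldPullbacks (A : AbelianVariety ℂ) :
    allWeilClasses A 3 ≤ Submodule.span ℂ (codimThreeWeilSixfoldPullbacks A) :=
  allWeilClasses_three_le_span_weilPullbacks A

/-! ## §2 (G) ⟹ (P⁺) in every dimension; (G) ⟹ (P) off dimension `6` -/

/-- **(G) ⟹ André's codimension-2 clause of (P) and (P⁺)**, every dimension.
[cite: vanGeemen1994HodgeAV, 4.9] [cite: Andre1992HodgeCM, Théorème] -/
theorem isCodimTwoGeneratedBy_weilPullbacks_of_isDivisorMultiWeilGenerated (hG : IsDivisorMultiWeilGenerated A) :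
    IsCodimTwoGeneratedBy A (codimTwoWeilPullbacks A) := fun c hc hH ↦
  sup_le_sup_left (allWeilClasses_two_le_span_codimTwoWeilPullbacks A) _ (hG 2 c hc hH)

/-- **(G) ⟹ the codimension-3 clause of (P⁺)**, every dimension. [cite: vanGeemen1994HodgeAV, 4.9 and Thm. 6.12]
[cite: MoonenZarhin1999LowDim, §5] -/
theorem isCodimThreeGeneratedBy_weilSixfoldPullbacks_of_isDivisorMultiWeilGenerated
    (hG : IsDivisorMultiWeilGenerated A) : IsCodimThreeGeneratedBy A (codimThreeWeilSixfoldPullbacks A) := by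
  intro c hc hH
  obtain ⟨y, hy, z, hz, rfl⟩ := Submodule.mem_sup.1 (hG 3 c hc hH)
  exact Submodule.mem_sup.2 ⟨y, Submodule.mem_sup_left hy, z,
    allWeilClasses_three_le_span_codimThreeWeilSixfoldPullbacks A hz, rfl⟩

/-- **(G) ⟹ (P⁺), UNCONDITIONALLY and in every dimension** (the LEAD's question: nothing beyond van Geemen 4.9 is
needed, and 4.9 is in the tree). [cite: vanGeemen1994HodgeAV, 4.9 and Thm. 6.12] [cite: MoonenZarhin1999LowDim, §5] -/
theorem isFullWeilPullbackGenerated_of_isDivisorMultiWeilGenerated (hG : IsDivisorMultiWeilGenerated A) :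
    IsFullWeilPullbackGenerated A :=
  ⟨isCodimTwoGeneratedBy_weilPullbacks_of_isDivisorMultiWeilGenerated hG,
    isCodimThreeGeneratedBy_weilSixfoldPullbacks_of_isDivisorMultiWeilGenerated hG⟩

/-- **`B = D` ⟹ (P⁺).** [cite: vanGeemen1994HodgeAV, §2.4–2.5] -/
theorem isFullWeilPullbackGenerated_of_isDivisorGenerated (h : IsDivisorGenerated A) : IsFullWeilPullbackGenerated A :=
  isFullWeilPullbackGenerated_of_isWeilPullbackGenerated (isWeilPullbackGenerated_of_isDivisorGenerated h)

/-- **(P⁺) is an upper bound of the member-shape family**: each of `B = D`, (G), (P) implies it.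
[cite: vanGeemen1994HodgeAV, §2.4–2.5 and 4.9] [cite: MoonenZarhin1999LowDim, §5] -/
theorem isFullWeilPullbackGenerated_of_shape
    (h : IsDivisorGenerated A ∨ IsDivisorMultiWeilGenerated A ∨ IsWeilPullbackGenerated A) :
    IsFullWeilPullbackGenerated A := by
  rcases h with h | h | h
  exacts [isFullWeilPullbackGenerated_of_isDivisorGenerated h,
    isFullWeilPullbackGenerated_of_isDivisorMultiWeilGenerated h, isFullWeilPullbackGenerated_of_isWeilPullbackGenerated h]

/-- **OFF DIMENSION `6`: (G) ⟹ (P) itself** (in degree `6` the Weil sum of (G) is `0` unless `dim A = 6`, so the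
codimension-3 clause of (G) is `B³ ⊗ ℂ ⊆ D³ ⊗ ℂ`). Covers odd dimension and row `7` (part XIX-B) and the Weil
FOURFOLDS; fails exactly in dimension `6` (part XIX, O1). [cite: vanGeemen1994HodgeAV, 4.9]
[cite: MoonenZarhin1999LowDim, Thm. 0.2 (e),(f) and §5] -/
theorem isWeilPullbackGenerated_of_isDivisorMultiWeilGenerated_of_dim_ne_six (hA : A.dim ≠ 6)
    (hG : IsDivisorMultiWeilGenerated A) : IsWeilPullbackGenerated A :=
  ⟨isCodimTwoGeneratedBy_weilPullbacks_of_isDivisorMultiWeilGenerated hG, fun c hc hH ↦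
    Submodule.mem_sup_left (mem_divisorClassesSpan_of_isDivisorMultiWeilGenerated_off_middle hG (by omega) hc hH)⟩

/-- **DIMENSION `6`, member form of O1 against (P⁺)**: a (G)-sixfold with ONE rational `(3,3)` class outside
`D³ ⊗ ℂ` satisfies (P⁺) and violates (P) — there (P⁺) is strictly weaker than (P) (members in print: the Weil-type
sixfolds, van Geemen Thm. 6.12 with 4.11). [cite: vanGeemen1994HodgeAV, Thm. 4.11 and Thm. 6.12] [cite: Weil1977HodgeRing] -/
theorem isFullWeilPullbackGenerated_and_not_isWeilPullbackGenerated_of_exceptional_three (hA : A.dim = 6)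
    (hG : IsDivisorMultiWeilGenerated A) {c : complexBetti A.X (2 * 3)} (hc : IsRationalClass c)
    (hH : IsOfHodgeType A.dim A.X (2 * 3) 3 3 c) (hn : c ∉ divisorClassesSpan A.X A.dim 3) :
    IsFullWeilPullbackGenerated A ∧ ¬ IsWeilPullbackGenerated A :=
  ⟨isFullWeilPullbackGenerated_of_isDivisorMultiWeilGenerated hG,
    not_isWeilPullbackGenerated_of_isDivisorMultiWeilGenerated_of_exceptional_three hA hG hc hH hn⟩

/-- **SIXFOLDS, the three shapes sorted**: under (G), (P⁺) always holds and (P) holds iff `B = D`.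
[cite: vanGeemen1994HodgeAV, §2.4–2.5, 4.9 and Thm. 6.12] [cite: MoonenZarhin1999LowDim, §5] -/
theorem shapes_of_isDivisorMultiWeilGenerated_six (hA : A.dim = 6) (hG : IsDivisorMultiWeilGenerated A) :
    IsFullWeilPullbackGenerated A ∧ (IsWeilPullbackGenerated A ↔ IsDivisorGenerated A) :=
  ⟨isFullWeilPullbackGenerated_of_isDivisorMultiWeilGenerated hG,
    fun hP ↦ isDivisorGenerated_of_multiWeil_of_isWeilPullbackGenerated_six hA hG hP,
    isWeilPullbackGenerated_of_isDivisorGenerated⟩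

/-! ## §3 (P⁺) descends along a section; the classes r5 found missing are (P⁺)-seeds -/

/-- Weil-sixfold pull-backs pull back to Weil-sixfold pull-backs: `i^*(g^* w) = (i ≫ g)^* w`.
[cite: HatcherAT2002, §3.2 Prop. 3.10] [cite: MoonenZarhin1999LowDim, §5] -/
theorem map_mem_codimThreeWeilSixfoldPullbacks (i : A'.X ⟶ A.X) {c : complexBetti A.X (2 * 3)}
    (hc : c ∈ codimThreeWeilSixfoldPullbacks A) :
    complexBetti.map i (2 * 3) c ∈ codimThreeWeilSixfoldPullbacks A' := by
  obtain ⟨B, g, d, ψ, w, hB, hd, hψ, hw, hwt, hwW, rfl⟩ := hc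
  exact ⟨B, i ≫ g, d, ψ, w, hB, hd, hψ, hw, hwt, hwW, (complexBetti.map_comp_apply' i g (2 * 3) w).symm⟩

/-- Spans of Weil-sixfold pull-backs pull back into spans of Weil-sixfold pull-backs. [cite: HatcherAT2002, §3.2 Prop. 3.10] -/
theorem map_mem_span_codimThreeWeilSixfoldPullbacks (i : A'.X ⟶ A.X) {c : complexBetti A.X (2 * 3)}
    (hc : c ∈ Submodule.span ℂ (codimThreeWeilSixfoldPullbacks A)) :
    complexBetti.map i (2 * 3) c ∈ Submodule.span ℂ (codimThreeWeilSixfoldPullbacks A') := by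
  induction hc using Submodule.span_induction with
  | mem x hx => exact Submodule.subset_span (map_mem_codimThreeWeilSixfoldPullbacks i hx)
  | zero => rw [map_zero]; exact zero_mem _
  | add x y _ _ hx hy => rw [map_add]; exact add_mem hx hy
  | smul a x _ hx => rw [map_smul]; exact Submodule.smul_mem _ a hx

/-- **Every pull-back of a rational `(3,3)` class of a (G)-variety is (P⁺)-generated**: for ANY morphism
`i : A' ⟶ A` of abelian varieties and (G) on `A`, `i^* c ∈ D³(A') ⊗ ℂ ⊔ span (Weil-sixfold pull-backs to A')`
(`c ∈ D³(A) ⊔ Σ_k W_k(A)`, §1, and both summands are stable under `i^*`). [cite: vanGeemen1994HodgeAV, 4.9 and Thm. 6.12]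
[cite: MoonenZarhin1999LowDim, §5] [cite: HatcherAT2002, §3.2 Prop. 3.10] -/
theorem map_mem_divisorClassesSpan_sup_span_seeds_of_isDivisorMultiWeilGenerated (i : A'.X ⟶ A.X)
    (hG : IsDivisorMultiWeilGenerated A) {c : complexBetti A.X (2 * 3)} (hc : IsRationalClass c)
    (hH : IsOfHodgeType A.dim A.X (2 * 3) 3 3 c) :
    complexBetti.map i (2 * 3) c ∈
      divisorClassesSpan A'.X A'.dim 3 ⊔ Submodule.span ℂ (codimThreeWeilSixfoldPullbacks A') := by
  have hA : IsSmoothProjective A.dim A.X := Motives.AbelianVariety.isSmoothProjective_holds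
  have hA' : IsSmoothProjective A'.dim A'.X := Motives.AbelianVariety.isSmoothProjective_holds
  obtain ⟨y, hy, z, hz, rfl⟩ := Submodule.mem_sup.1 (hG 3 c hc hH)
  rw [map_add]
  exact Submodule.mem_sup.2 ⟨_, map_mem_divisorClassesSpan hA hA' i hy, _,
    map_mem_span_codimThreeWeilSixfoldPullbacks i (allWeilClasses_three_le_span_codimThreeWeilSixfoldPullbacks A hz),
    rfl⟩

section Retract

variable {i : A'.X ⟶ A.X} {r : A.X ⟶ A'.X}

/-- **Codimension-3 generation by a seed set DESCENDS to a retract**, seeds pushed along `i^*`.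
[cite: MoonenZarhin1999LowDim, §2 and §5] [cite: Fulton1998, §10.1] -/
theorem isCodimThreeGeneratedBy_of_retract (hir : i ≫ r = 𝟙 A'.X) {T : Set (complexBetti A.X (2 * 3))}
    (hP : IsCodimThreeGeneratedBy A T) : IsCodimThreeGeneratedBy A' (complexBetti.map i (2 * 3) '' T) := by
  intro c hc hH
  have hA : IsSmoothProjective A.dim A.X := Motives.AbelianVariety.isSmoothProjective_holds
  have hA' : IsSmoothProjective A'.dim A'.X := Motives.AbelianVariety.isSmoothProjective_holds
  obtain ⟨yz, hyz, t, ht, hsum⟩ := Submodule.mem_sup.1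
    (hP (complexBetti.map r (2 * 3) c) (hc.pullback _) (hH.map_of_isSmoothProjective hA hA' r))
  obtain ⟨y, hy, z, hz, rfl⟩ := Submodule.mem_sup.1 hyz
  rw [← map_map_of_retract i r hir (2 * 3) c, ← hsum, map_add, map_add]
  exact Submodule.mem_sup.2 ⟨_, Submodule.mem_sup.2 ⟨_, map_mem_divisorClassesSpan hA hA' i hy, _,
    map_mem_span_codimTwo_cup_codimOne i hz, rfl⟩, _, (Submodule.map_span _ _).le (Submodule.mem_map_of_mem ht), rfl⟩

/-- **(P⁺) DESCENDS to a retract** (both seed sets are stable under `i^*`). [cite: Andre1992HodgeCM, Théorème]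
[cite: MoonenZarhin1999LowDim, §5] [cite: Fulton1998, §10.1] -/
theorem isFullWeilPullbackGenerated_of_retract (hir : i ≫ r = 𝟙 A'.X) (hP : IsFullWeilPullbackGenerated A) :
    IsFullWeilPullbackGenerated A' := by
  refine ⟨(isCodimTwoGeneratedBy_of_retract hir hP.1).mono ?_, (isCodimThreeGeneratedBy_of_retract hir hP.2).mono ?_⟩
  · rintro _ ⟨x, hx, rfl⟩
    exact map_mem_codimTwoWeilPullbacks i hx
  · rintro _ ⟨x, hx, rfl⟩
    exact map_mem_codimThreeWeilSixfoldPullbacks i hx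

end Retract

section Product

variable {T Y : AbelianVariety ℂ}

/-- **(P⁺) of `T × Y` descends to BOTH factors** (slices are sections of the projections).
[cite: MoonenZarhin1999LowDim, §3 (3.1) and §5] [cite: Fulton1998, §10.1] -/
theorem isFullWeilPullbackGenerated_of_prod (h : IsFullWeilPullbackGenerated (T.prod Y)) :
    IsFullWeilPullbackGenerated T ∧ IsFullWeilPullbackGenerated Y :=
  ⟨isFullWeilPullbackGenerated_of_retract (A := T.prod Y) (sliceAt_fst T.X (1 : Y.Points ℂ)) h,
    isFullWeilPullbackGenerated_of_retract (A := T.prod Y) (rightSlice_snd T Y) h⟩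

/-- **The classes r5 found missing from (P) on `T × Y₆` are (P⁺)-seeds, BY NAME**: `pr₂^* w` for a rational
`(3,3)` Weil class `w` of the sixfold factor. [cite: vanGeemen1994HodgeAV, Thm. 6.12] [cite: MoonenZarhin1999LowDim, §5] -/
theorem map_snd_mem_codimThreeWeilSixfoldPullbacks (T : AbelianVariety ℂ) (hY : Y.dim = 6) {d : ℕ} (hd : 0 < d)
    {ψ : Y ⟶ Y} (hψ : ψ ≫ ψ = -(d • 𝟙 Y)) {w : complexBetti Y.X (2 * 3)} (hw : IsRationalClass w)
    (hwt : IsOfHodgeType Y.dim Y.X (2 * 3) 3 3 w) (hwW : w ∈ weilClassesOf Y ψ 3 d) :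
    complexBetti.map (CartesianMonoidalCategory.snd T.X Y.X) (2 * 3) w ∈ codimThreeWeilSixfoldPullbacks (T.prod Y) :=
  map_snd_mem_weilSixfoldPullbacks hY hd hψ hw hwt hwW

/-- **… and so is the pull-back of the factor's whole Weil sum `Σ_k W_k ⊗ ℂ`** (degree `6`).
[cite: vanGeemen1994HodgeAV, 4.9 and 4.13] [cite: MoonenZarhin1999LowDim, §5] -/
theorem map_snd_mem_span_codimThreeWeilSixfoldPullbacks_of_mem_allWeilClasses (T : AbelianVariety ℂ)
    {w : complexBetti Y.X (2 * 3)} (hw : w ∈ allWeilClasses Y 3) :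
    complexBetti.map (CartesianMonoidalCategory.snd T.X Y.X) (2 * 3) w ∈
      Submodule.span ℂ (codimThreeWeilSixfoldPullbacks (T.prod Y)) :=
  map_mem_span_codimThreeWeilSixfoldPullbacks (A' := T.prod Y) _
    (allWeilClasses_three_le_span_codimThreeWeilSixfoldPullbacks Y hw)

/-- **For a (G)-factor `Y`, every pulled-back class `pr₂^* c` (`c` a rational `(3,3)` class of `Y`) is
(P⁺)-generated on `T × Y`**: it lies in `D³(T × Y) ⊗ ℂ ⊔ span (Weil-sixfold pull-backs)`. This is the exact repair of
r5's defect (part XX: (P) FAILS on `T × Y₆`); whether `T × Y` has (P⁺) is a statement about the mixed Künneth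
components and stays a member hypothesis. [cite: vanGeemen1994HodgeAV, Thm. 6.12] [cite: MoonenZarhin1999LowDim, §3 and §5] -/
theorem map_snd_mem_divisorClassesSpan_sup_span_seeds_of_isDivisorMultiWeilGenerated (T : AbelianVariety ℂ)
    (hG : IsDivisorMultiWeilGenerated Y) {c : complexBetti Y.X (2 * 3)} (hc : IsRationalClass c)
    (hH : IsOfHodgeType Y.dim Y.X (2 * 3) 3 3 c) :
    complexBetti.map (CartesianMonoidalCategory.snd T.X Y.X) (2 * 3) c ∈
      divisorClassesSpan (T.prod Y).X (T.prod Y).dim 3 ⊔ Submodule.span ℂ (codimThreeWeilSixfoldPullbacks (T.prod Y)) :=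
  map_mem_divisorClassesSpan_sup_span_seeds_of_isDivisorMultiWeilGenerated (A' := T.prod Y) _ hG hc hH

/-- **`T × Y₆` with a (G)-sixfold factor carrying one exceptional `(3,3)` class: (P) fails (part XX, r5) while the
factor has (P⁺) and its classes pull back to (P⁺)-generated classes.** [cite: vanGeemen1994HodgeAV, Thm. 4.11 and 6.12]
[cite: MoonenZarhin1999LowDim, §5] -/
theorem prod_weilSixfold_not_P_and_factor_fullShape (T : AbelianVariety ℂ) (hY : Y.dim = 6)
    (hG : IsDivisorMultiWeilGenerated Y) {c : complexBetti Y.X (2 * 3)} (hc : IsRationalClass c)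
    (hH : IsOfHodgeType Y.dim Y.X (2 * 3) 3 3 c) (hn : c ∉ divisorClassesSpan Y.X Y.dim 3) :
    ¬ IsWeilPullbackGenerated (T.prod Y) ∧ IsFullWeilPullbackGenerated Y ∧
      complexBetti.map (CartesianMonoidalCategory.snd T.X Y.X) (2 * 3) c ∈
        divisorClassesSpan (T.prod Y).X (T.prod Y).dim 3 ⊔
          Submodule.span ℂ (codimThreeWeilSixfoldPullbacks (T.prod Y)) :=
  ⟨(not_isWeilPullbackGenerated_prod_of_multiWeil_of_exceptional_three T hY hG hc hH hn).2,
    isFullWeilPullbackGenerated_of_isDivisorMultiWeilGenerated hG,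
    map_snd_mem_divisorClassesSpan_sup_span_seeds_of_isDivisorMultiWeilGenerated T hG hc hH⟩

end Product

/-! ## §4 (P⁺) does not rescue (G) -/

/-- **(P⁺) ⇏ (G)**: in dimension `≠ 4`, one rational `(2,2)` class outside `D² ⊗ ℂ` kills (G) whatever else holds
(members: the K3 partners in dimension `6`, their dim-7 twins, cell computation K3-WP).
[cite: MoonenZarhin1999LowDim, Thm. 0.2 (e),(f) and §5] [cite: vanGeemen1994HodgeAV, 4.9] -/
theorem not_isDivisorMultiWeilGenerated_of_isFullWeilPullbackGenerated_of_exceptional_two (hA : A.dim ≠ 4)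
    (_hP : IsFullWeilPullbackGenerated A) {c : complexBetti A.X (2 * 2)} (hc : IsRationalClass c)
    (hH : IsOfHodgeType A.dim A.X (2 * 2) 2 2 c) (hn : c ∉ divisorClassesSpan A.X A.dim 2) :
    ¬ IsDivisorMultiWeilGenerated A :=
  fun hG ↦ hn (mem_divisorClassesSpan_of_isDivisorMultiWeilGenerated_off_middle hG (by omega) hc hH)

/-! ## §5 Rows `6, 7` and the census from "one of the four shapes" off a class -/

open WeilTypeLadder Ring2Transport Ring2.Atlas Ring2.Motiv

/-- **The census clauses X2′ ∧ X1 off `𝒞`** from: every 6- and 7-fold outside `𝒞` has ONE OF the shapes `B = D`,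
(G), (P), (P⁺) (typer 1's `censusOff_of_forall_isFullWeilPullbackGenerated` after §2).
[cite: MoonenZarhin1999LowDim, Thm. 0.2 (e),(f) and §5] -/
theorem censusOff_of_forall_shape {𝒞 : AbelianVariety ℂ → Prop}
    (h : ∀ A : AbelianVariety ℂ, A.dim = 6 ∨ A.dim = 7 → ¬ 𝒞 A →
      IsDivisorGenerated A ∨ IsDivisorMultiWeilGenerated A ∨ IsWeilPullbackGenerated A ∨
        IsFullWeilPullbackGenerated A) :
    CodimTwoFromWeilPullbacksOff 𝒞 ∧ CodimThreeWeilGenerationOff 𝒞 :=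
  censusOff_of_forall_isFullWeilPullbackGenerated fun A hA hA𝒞 ↦ by
    rcases h A hA hA𝒞 with h | h | h | h
    exacts [isFullWeilPullbackGenerated_of_isDivisorGenerated h,
      isFullWeilPullbackGenerated_of_isDivisorMultiWeilGenerated h,
      isFullWeilPullbackGenerated_of_isWeilPullbackGenerated h, h]

/-- **Rows `≤ 7` from HC on `𝒞`, the floor `HCUpToDim 5`, the floor fact, the two prices off `𝒞`, and ONE OF the
four shapes on every 6- and 7-fold outside `𝒞`** (typer 1's per-member theorem after §2; `HC_CM` ABSENT — it enters
only for `𝒞 = CM`, as HC on `𝒞`). [cite: MoonenZarhin1999LowDim, Thms. 0.1, 0.2 and §5]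
[cite: Markman2025SecantWeil, Thm. 1.5.1 (preprint, unrefereed)] -/
theorem hcUpToDim_seven_of_forall_shape_off {𝒞 : AbelianVariety ℂ → Prop} (h𝒞 : HCOnClass 𝒞)
    (h : ∀ A : AbelianVariety ℂ, A.dim = 6 ∨ A.dim = 7 → ¬ 𝒞 A →
      IsDivisorGenerated A ∨ IsDivisorMultiWeilGenerated A ∨ IsWeilPullbackGenerated A ∨
        IsFullWeilPullbackGenerated A)
    (hW : Markman2025_weilClasses_algebraic_abelianFourfold) (h₆ : CodimTwoWeilClassesCMFieldOff 𝒞)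
    (h₄ : WeilSixfoldsOff 𝒞) (h₅ : HCUpToDim 5) : HCUpToDim 7 :=
  hcUpToDim_seven_of_forall_isFullWeilPullbackGenerated_off h𝒞 (fun A hA hA𝒞 ↦ by
    rcases h A hA hA𝒞 with h | h | h | h
    exacts [isFullWeilPullbackGenerated_of_isDivisorGenerated h,
      isFullWeilPullbackGenerated_of_isDivisorMultiWeilGenerated h,
      isFullWeilPullbackGenerated_of_isWeilPullbackGenerated h, h]) hW h₆ h₄ h₅

-- Audit under `HodgeConjecture`: part XIX's `multiWeilVsPullbacks_audit_of_hodgeConjecture` and typer 1's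
-- `fullWeilPullbackGenerated_prices_of_hodgeConjecture` (reused by name, not restated).

end Summit.HodgeConjecture.HodgeConjecture.Ring2.Hypotheses
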